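import Summits.BirchSwinnertonDyer.Rank1Residual.GaloisImage.HauptmodulDeltaUnitValuation
import HarnessLib

/-!
# The level-`9` Hauptmodul at `v₃(j) = 7` is VALUATION-FORCED after a unit normalisation:
# `v(z)⁹ = v(3)⁴` for `z = (9θ/(2(θ³ − 24)))² − 1` (`j/3⁷ ≡ ±1 (mod 9)`) and for
# `z = (81θ/(2(θ³ − 24)(θ³ − 15)))² − 1` (`j/3⁷ ≡ 5, 7 (mod 9)`)
# (cell `b2b-bsdres`, team n1011, seat p02 gen 6 — row T-b11-F4, file F4c-H16 'Hauptmodul route,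
# curve-free core at v₃(j) = 7'; pure valuation algebra in `ℚ̄`)

HONEST FRAMING (cell `b2b-bsdres`, run/shared/lean/b2b/bsd-rank1-residual/, verbatim in every
file): the goal of the cell is to DELETE the COMBINATION-SHAPED residual classes of the
Birch–Swinnerton-Dyer formula for ALL analytic-rank `≤ 1` elliptic curves over `ℚ` — "full BSD
formula for every rank `≤ 1` curve in class `C`" assembled STRICTLY from published theorems — so
that the rank-`≤ 1` remainder becomes exactly the CONSTRUCTION-SHAPED classes, which are TYPED
(missing-input `Prop`s), NOT attempted. This is not "finishing BSD". Team n1011 (N10 / N11):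
research route; no claim beyond the stated classes; labels UNCHANGED; nothing is booked. Theorems
only (no definition, no named fact).

## What this file proves

`v` the place of `ℚ̄` over `3`, `t = v(3)`; `K = j/3⁷` (a `3`-adic unit), `S = θ³ = 3(δ + 8)` the
level-`3` Hauptmodul at a NON-canonical `3`-torsion group (`v(S) = t`), so that
`δ³(δ + 8) = 81K(δ − 1)` and `v(δ)³ = t⁴` (`HauptmodulDeltaUnitValuation`).

* `valuation_numerator_seven_pm` (§1) — `K ≡ ε (mod 9)`, `ε = ±1`:
  `v(εδ² + (16ε − 8K)δ + (64ε + 8K)) = v(δ)`.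
* **`valuation_hauptmodul_nine_invariant_seven_pm_pow_nine`** (§1) — `9 ∣ num(j/3⁷ − ε)`:
  **`v((9θ/(2(θ³ − 24)))² − 1)⁹ = t⁴`**.  (`X = 3εθ/(2δ)` has `(X³ − 1)·8δ³(δ + 8) = 81·N` with
  `N` the numerator above, so `v(X³ − 1) = v(δ) = t^{4/3}`; cube-root lemma.)
* `valuation_numerator_seven_e1` (§2) — `K ≡ ε − 3 (mod 9)` (`K ≡ 7, 5`):
  `v(27ε(δ + 8)² − 8K(δ − 1)(δ + 3)³) = t³·v(δ)` (after multiplying by `δ + 8` the dominant term is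
  `27(192ε + 8K + 48K²)δ`; the constant `27(512ε + 64K − 24K²)` is `O(3⁵)`).
* **`valuation_hauptmodul_nine_invariant_seven_e1_pow_nine`** (§2) — `9 ∣ num(j/3⁷ − (ε − 3))`:
  **`v((81θ/(2(θ³ − 24)(θ³ − 15)))² − 1)⁹ = t⁴`** (`X = 9εθ/(2δ(δ + 3))`).

MECHANISM (the unit normalisation): `Y = 3θ/(2δ)` satisfies `Y³ = (δ + 8)²/(8K(δ − 1))` EXACTLY,
a unit `≡ K⁻¹`; for `K ≡ ±1 (mod 9)` already `ord(Y³ ∓ 1) = ord(δ) = 4/3 < 3/2`, and for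
`K ≡ ε − 3` one divides by the one-unit `1 + δ/3` (`δ/3` a uniformiser of `ℚ₃(δ)`), which removes
the digits of order `1`.  For `E/ℚ` in these classes and a cyclic `C ⊂ E[9]` over a non-canonical
`3`-torsion group, `θ = η(E, C) + 3` satisfies the hypotheses, so `z ∈ ℚ(C)` is a `Stab(C)`-invariant
of valuation `4/9` and the scalar-stabiliser criterion gives the `3`-adic tower from surj(3)
(`HauptmodulNineTowerSeven`; 41 census cells at `v₃(j) = 7`: 26 with `K ≡ ±1`, 15 with
`K ≡ 5, 7`; EVIDENCE kit j135897, 41/41; the 27 cells with `K ≡ 2, 4 (mod 9)` have no prime of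
`ℚ(θ)` over `3` with `9 ∣ ef` and are NOT covered).  Nothing booked.

References: [Maier2006] Table 4 (N = 3, 9), §5.
-/

noncomputable section

set_option maxRecDepth 10000

open scoped Classical

namespace Summit.BirchSwinnertonDyer.Rank1Residual.GaloisImage

open Literature.NumberTheory.EllipticCurves Literature.NumberTheory.GaloisRepresentations
  Rat.HeightOneSpectrum

/-! ### §1 `K ≡ ±1 (mod 9)`: `X = 3εθ/(2δ)` -/

/-- **`v(εδ² + (16ε − 8K)δ + (64ε + 8K)) = v(δ)`** for `ε = ±1`, `v(K − ε) ≤ v(3)²` and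
`v(δ)³ = v(3)⁴`: the middle coefficient `16ε − 8K = 8ε − 8(K − ε)` is a unit, `v(εδ²) = v(δ)² <
v(δ)` and `64ε + 8K = 72ε + 8(K − ε)` is `O(9)`, `v(3)² < v(δ)`. [folklore] -/
theorem valuation_numerator_seven_pm {δ K ε : AlgebraicClosure ℚ} (hε : ε = 1 ∨ ε = -1)
    (hKε : (placeOver 3).valuation (K - ε) ≤ (placeOver 3).valuation (3 : AlgebraicClosure ℚ) ^ 2)
    (hδ : (placeOver 3).valuation δ ^ 3 = (placeOver 3).valuation (3 : AlgebraicClosure ℚ) ^ 4) :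
    (placeOver 3).valuation (ε * δ ^ 2 + (16 * ε - 8 * K) * δ + (64 * ε + 8 * K)) =
      (placeOver 3).valuation δ := by
  set v := (placeOver 3).valuation with hv
  set t := v (3 : AlgebraicClosure ℚ) with ht
  set s := v δ with hs
  have ht1 : t < 1 := valuation_three_lt_one
  obtain ⟨hst, ht2s, hs0⟩ := valuation_delta_facts_seven hδ
  have hs1 : s < 1 := hst.trans ht1
  have hvε : v ε = 1 := by
    rcases hε with h | h
    · rw [h, map_one]
    · rw [h, Valuation.map_neg, map_one]
  have h8 : v (8 : AlgebraicClosure ℚ) = 1 := by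
    simpa using valuation_intCast_eq_one_of_not_dvd (n := 8) (by decide)
  -- the middle coefficient is a unit
  have hmid : v (16 * ε - 8 * K) = 1 := by
    have e : 16 * ε - 8 * K = 8 * ε - 8 * (K - ε) := by ring
    have h1 : v (8 * ε) = 1 := by rw [map_mul, h8, hvε, mul_one]
    have h2 : v (8 * (K - ε)) < v (8 * ε) := by
      rw [h1, map_mul, h8, one_mul]
      exact hKε.trans_lt (pow_lt_one₀ zero_le ht1 two_ne_zero)
    rw [e, valuation_sub_eq_of_lt h2, h1]
  have hmain : v ((16 * ε - 8 * K) * δ) = s := by rw [map_mul, hmid, one_mul]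
  -- the other two terms are smaller
  have hsq : v (ε * δ ^ 2) < s := by
    rw [map_mul, hvε, one_mul, map_pow]
    calc s ^ 2 = s * s := pow_two s
      _ < s * 1 := mul_lt_mul_of_pos_left hs1 (zero_lt_iff.mpr hs0)
      _ = s := mul_one s
  have hconst : v (64 * ε + 8 * K) < s := by
    have e : 64 * ε + 8 * K = 8 * 3 ^ 2 * ε + 8 * (K - ε) := by ring
    rw [e]
    refine lt_of_le_of_lt (Valuation.map_add _ _ _) (max_lt ?_ ?_)
    · rw [map_mul, map_mul, map_pow, h8, hvε, one_mul, mul_one]; exact ht2s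
    · rw [map_mul, h8, one_mul]; exact hKε.trans_lt ht2s
  have e : ε * δ ^ 2 + (16 * ε - 8 * K) * δ + (64 * ε + 8 * K) =
      (16 * ε - 8 * K) * δ + (ε * δ ^ 2 + (64 * ε + 8 * K)) := by ring
  rw [e, Valuation.map_add_eq_of_lt_left _ (by
    rw [hmain]; exact lt_of_le_of_lt (Valuation.map_add _ _ _) (max_lt hsq hconst)), hmain]

/-- **The level-`9` Hauptmodul at `v₃(j) = 7`, `j/3⁷ ≡ ±1 (mod 9)` is valuation-forced.**  Let
`ε = ±1`, `j ∈ ℚ` with `9 ∣ num(j/3⁷ − ε)`, and `S, θ ∈ ℚ̄` with `j(S − 27) = S(S − 24)³`,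
`v(S) = v(3)` and `θ³ = S`.  Then **`v((9θ/(2(θ³ − 24)))² − 1)⁹ = v(3)⁴`** — `3`-adic valuation
exactly `4/9`. [cite: Maier2006, Table 4 (N = 3, 9) and §5] -/
theorem valuation_hauptmodul_nine_invariant_seven_pm_pow_nine {j : ℚ} {ε : ℤ}
    (hε : ε = 1 ∨ ε = -1) (hj0 : (9 : ℤ) ∣ (j / 3 ^ 7 - ε).num)
    {S θ : AlgebraicClosure ℚ}
    (hS : algebraMap ℚ (AlgebraicClosure ℚ) j * (S - 27) = S * (S - 24) ^ 3)
    (hvS : (placeOver 3).valuation S = (placeOver 3).valuation (3 : AlgebraicClosure ℚ))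
    (hθ : θ ^ 3 = S) :
    (placeOver 3).valuation ((9 * θ / (2 * (θ ^ 3 - 24))) ^ 2 - 1) ^ 9 =
      (placeOver 3).valuation (3 : AlgebraicClosure ℚ) ^ 4 := by
  set v := (placeOver 3).valuation with hv
  set t := v (3 : AlgebraicClosure ℚ) with ht
  have ht0 : t ≠ 0 := valuation_three_ne_zero
  have h3 : (3 : AlgebraicClosure ℚ) ≠ 0 := by norm_num
  have hε3 : ¬ (3 : ℤ) ∣ ε := by rcases hε with h | h <;> rw [h] <;> decide
  have hε' : (ε : AlgebraicClosure ℚ) = 1 ∨ (ε : AlgebraicClosure ℚ) = -1 := by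
    rcases hε with h | h
    · left; rw [h]; norm_num
    · right; rw [h]; norm_num
  have hε3' : (ε : AlgebraicClosure ℚ) ^ 3 = ε := by rcases hε' with h | h <;> rw [h] <;> norm_num
  -- `K = j/3⁷ ≡ ε (mod 9)`
  obtain ⟨hKε, hK, hjK⟩ := valuation_facts_of_nine_dvd_num_sub (V := 7) hε3 hj0
  set K := algebraMap ℚ (AlgebraicClosure ℚ) (j / 3 ^ 7) with hKdef
  -- `S = 3(δ + 8)`
  obtain ⟨δ, hSδ⟩ : ∃ δ : AlgebraicClosure ℚ, S = 3 * (δ + 8) := ⟨S / 3 - 8, by field_simp; ring⟩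
  subst hSδ
  have hR := delta_quartic_of_hauptmodul_three (n := 4) hjK hS rfl
  have h81 : ((3 : AlgebraicClosure ℚ) ^ 4) = 81 := by norm_num
  rw [h81] at hR
  have h8 : v (δ + 8) = 1 := by
    have e : t * v (δ + 8) = t * 1 := by rw [mul_one, ← map_mul]; exact hvS
    exact mul_left_cancel₀ ht0 e
  obtain ⟨h1, hδ3⟩ := valuation_delta_of_quartic (n := 4) hK h8 (by rw [h81]; exact hR)
  set s := v δ with hs
  obtain ⟨-, -, hs0⟩ := valuation_delta_facts_seven hδ3
  have hδ0 : δ ≠ 0 := (Valuation.ne_zero_iff _).mp hs0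
  have hP0 : δ + 8 ≠ 0 := (Valuation.ne_zero_iff _).mp (by rw [h8]; exact one_ne_zero)
  -- `Y = 9θ/(2(θ³ − 24)) = 3θ/(2δ)`
  have hθδ : θ ^ 3 - 24 = 3 * δ := by rw [hθ]; ring
  set Y := 9 * θ / (2 * (θ ^ 3 - 24)) with hYdef
  have hY : Y * (2 * δ) = 3 * θ := by
    have hne : 2 * (θ ^ 3 - 24) ≠ 0 := by rw [hθδ]; exact mul_ne_zero two_ne_zero (mul_ne_zero h3 hδ0)
    have e : Y * (2 * (θ ^ 3 - 24)) = 9 * θ := div_mul_cancel₀ _ hne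
    rw [hθδ] at e
    have e' : 3 * (Y * (2 * δ) - 3 * θ) = 0 := by linear_combination e
    exact sub_eq_zero.mp ((mul_eq_zero.mp e').resolve_left h3)
  -- `(X³ − 1)·8δ³(δ + 8) = 81·N`
  have hX3 : (((ε : AlgebraicClosure ℚ) * Y) ^ 3 - 1) * (8 * δ ^ 3 * (δ + 8)) =
      81 * (ε * δ ^ 2 + (16 * ε - 8 * K) * δ + (64 * ε + 8 * K)) := by
    linear_combination ((ε : AlgebraicClosure ℚ) ^ 3 * (δ + 8) *
        ((Y * (2 * δ)) ^ 2 + Y * (2 * δ) * (3 * θ) + 9 * θ ^ 2)) * hY +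
      (27 * (ε : AlgebraicClosure ℚ) ^ 3 * (δ + 8)) * hθ + (81 * (δ + 8) ^ 2) * hε3' + (-8) * hR
  have hN := valuation_numerator_seven_pm hε' hKε hδ3
  have h8v : v (8 : AlgebraicClosure ℚ) = 1 := by
    simpa using valuation_intCast_eq_one_of_not_dvd (n := 8) (by decide)
  have h81v : v (81 : AlgebraicClosure ℚ) = t ^ 4 := by rw [← h81, map_pow]
  have hval := congrArg v hX3
  rw [map_mul, map_mul, map_mul, map_pow, h8v, one_mul, h8, mul_one, map_mul, h81v, hN, hδ3] at hval
  -- `hval : A * t⁴ = t⁴ * s`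
  have hA : v (((ε : AlgebraicClosure ℚ) * Y) ^ 3 - 1) = s := by
    rw [mul_comm] at hval
    exact mul_left_cancel₀ (pow_ne_zero 4 ht0) hval
  have hcube : v (((ε : AlgebraicClosure ℚ) * Y) ^ 3 - 1) ^ 3 = t ^ 4 := by rw [hA, hs, hδ3]
  exact valuation_sq_sub_one_pow_nine_of_cube_pow_four hε' hcube

/-! ### §2 `K ≡ ε − 3 (mod 9)`: `X = 9εθ/(2δ(δ + 3))` -/

/-- **`v(27ε(δ + 8)² − 8K(δ − 1)(δ + 3)³) = v(3)³·v(δ)`** for `ε = ±1`, `v(K − (ε − 3)) ≤ v(3)²`,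
`v(K) = 1`, `v(δ + 8) = 1`, `δ³(δ + 8) = 81K(δ − 1)` and `v(δ)³ = v(3)⁴`.  Multiplying by `δ + 8`
and using the quartic once: `N(δ + 8) = 27B − 72Kδ²(δ − 1)(δ + 8)` with
`B = (ε − 8K)δ³ + (24ε − 64K − 24K²)δ² + (192ε + 8K + 48K²)δ + (512ε + 64K − 24K²)`; the term
`27(192ε + 8K + 48K²)δ` dominates (`8K` a unit; `512ε + 64K − 24K² = 9(80ε − 48) + D(208 − 24D − 48ε)`
with `D = K − ε + 3`). [folklore] -/
theorem valuation_numerator_seven_e1 {δ K ε : AlgebraicClosure ℚ} (hε : ε = 1 ∨ ε = -1)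
    (hKε : (placeOver 3).valuation (K - (ε - 3)) ≤ (placeOver 3).valuation (3 : AlgebraicClosure ℚ) ^ 2)
    (hK : (placeOver 3).valuation K = 1)
    (h8 : (placeOver 3).valuation (δ + 8) = 1)
    (hR : δ ^ 3 * (δ + 8) = 81 * K * (δ - 1))
    (hδ : (placeOver 3).valuation δ ^ 3 = (placeOver 3).valuation (3 : AlgebraicClosure ℚ) ^ 4) :
    (placeOver 3).valuation (27 * ε * (δ + 8) ^ 2 - 8 * K * (δ - 1) * (δ + 3) ^ 3) =
      (placeOver 3).valuation (3 : AlgebraicClosure ℚ) ^ 3 * (placeOver 3).valuation δ := by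
  set v := (placeOver 3).valuation with hv
  set t := v (3 : AlgebraicClosure ℚ) with ht
  set s := v δ with hs
  have ht1 : t < 1 := valuation_three_lt_one
  have ht0 : t ≠ 0 := valuation_three_ne_zero
  have ht0' : 0 < t := zero_lt_iff.mpr ht0
  obtain ⟨hst, ht2s, hs0⟩ := valuation_delta_facts_seven hδ
  have hs1 : s < 1 := hst.trans ht1
  have hs0' : 0 < s := zero_lt_iff.mpr hs0
  have hsq : ε ^ 2 = 1 := by rcases hε with h | h <;> rw [h] <;> norm_num
  have hvε : v ε = 1 := by
    rcases hε with h | h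
    · rw [h, map_one]
    · rw [h, Valuation.map_neg, map_one]
  have hunit : ∀ n : ℤ, ¬ (3 : ℤ) ∣ n → v (n : AlgebraicClosure ℚ) = 1 := fun n hn ↦
    valuation_intCast_eq_one_of_not_dvd hn
  have h8v : v (8 : AlgebraicClosure ℚ) = 1 := by simpa using hunit 8 (by decide)
  have h27 : v (27 : AlgebraicClosure ℚ) = t ^ 3 := by
    rw [show (27 : AlgebraicClosure ℚ) = 3 ^ 3 by norm_num, map_pow]
  have h1 : v (δ - 1) = 1 := by
    have e : δ - 1 = (δ + 8) - 9 := by ring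
    have h9 : v (9 : AlgebraicClosure ℚ) < v (δ + 8) := by
      rw [h8, show (9 : AlgebraicClosure ℚ) = 3 ^ 2 by norm_num, map_pow]
      exact pow_lt_one₀ zero_le ht1 two_ne_zero
    rw [e, valuation_sub_eq_of_lt h9, h8]
  -- the identity for `N(δ + 8)`
  set D := K - (ε - 3) with hD
  have hid : (27 * ε * (δ + 8) ^ 2 - 8 * K * (δ - 1) * (δ + 3) ^ 3) * (δ + 8) =
      27 * ((192 * ε + 8 * K + 48 * K ^ 2) * δ) +
        (27 * ((ε - 8 * K) * δ ^ 3) + 27 * ((24 * ε - 64 * K - 24 * K ^ 2) * δ ^ 2) +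
          27 * (512 * ε + 64 * K - 24 * K ^ 2) - 72 * K * δ ^ 2 * (δ - 1) * (δ + 8)) := by
    linear_combination (-8 * K * (δ - 1)) * hR
  -- the main term
  have hc1 : v (192 * ε + 8 * K + 48 * K ^ 2) = 1 := by
    have e : 192 * ε + 8 * K + 48 * K ^ 2 = 8 * K + 3 * (64 * ε + 16 * K ^ 2) := by ring
    have h8K : v (8 * K) = 1 := by rw [map_mul, h8v, hK, mul_one]
    have hlt : v (3 * (64 * ε + 16 * K ^ 2)) < v (8 * K) := by
      rw [h8K, map_mul]
      have h64 : v (64 * ε + 16 * K ^ 2) ≤ 1 := by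
        refine (Valuation.map_add _ _ _).trans (max_le ?_ ?_)
        · rw [map_mul, hvε, mul_one, show (64 : AlgebraicClosure ℚ) = ((64 : ℤ) : AlgebraicClosure ℚ)
            by norm_num, hunit 64 (by decide)]
        · rw [map_mul, map_pow, hK, one_pow, mul_one,
            show (16 : AlgebraicClosure ℚ) = ((16 : ℤ) : AlgebraicClosure ℚ) by norm_num,
            hunit 16 (by decide)]
      calc t * v (64 * ε + 16 * K ^ 2) ≤ t * 1 := mul_le_mul' le_rfl h64
        _ < 1 := by rw [mul_one]; exact ht1
    rw [e, Valuation.map_add_eq_of_lt_left _ hlt, h8K]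
  have hmain : v (27 * ((192 * ε + 8 * K + 48 * K ^ 2) * δ)) = t ^ 3 * s := by
    rw [map_mul, h27, map_mul, hc1, one_mul]
  -- the rest is smaller than `t³ s`
  have hεle : v ε ≤ 1 := hvε.le
  have hr1 : v (27 * ((ε - 8 * K) * δ ^ 3)) < t ^ 3 * s := by
    rw [map_mul, h27, map_mul, map_pow]
    have hc : v (ε - 8 * K) ≤ 1 :=
      (Valuation.map_sub _ _ _).trans (max_le hεle (by rw [map_mul, h8v, hK, mul_one]))
    have hs3 : s ^ 3 < s := by
      calc s ^ 3 = s ^ 2 * s := pow_succ s 2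
        _ < 1 * s := mul_lt_mul_of_pos_right (pow_lt_one₀ zero_le hs1 two_ne_zero) hs0'
        _ = s := one_mul s
    calc t ^ 3 * (v (ε - 8 * K) * s ^ 3) ≤ t ^ 3 * (1 * s ^ 3) :=
          mul_le_mul' le_rfl (mul_le_mul' hc le_rfl)
      _ = t ^ 3 * s ^ 3 := by rw [one_mul]
      _ < t ^ 3 * s := mul_lt_mul_of_pos_left hs3 (pow_pos ht0' 3)
  have hr2 : v (27 * ((24 * ε - 64 * K - 24 * K ^ 2) * δ ^ 2)) < t ^ 3 * s := by
    rw [map_mul, h27, map_mul, map_pow]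
    have hc : v (24 * ε - 64 * K - 24 * K ^ 2) ≤ 1 := by
      refine (Valuation.map_sub _ _ _).trans (max_le ((Valuation.map_sub _ _ _).trans (max_le ?_ ?_)) ?_)
      · rw [map_mul, hvε, mul_one, show (24 : AlgebraicClosure ℚ) = 8 * 3 by norm_num, map_mul, h8v,
          one_mul]; exact ht1.le
      · rw [map_mul, hK, mul_one, show (64 : AlgebraicClosure ℚ) = ((64 : ℤ) : AlgebraicClosure ℚ)
          by norm_num, hunit 64 (by decide)]
      · rw [map_mul, map_pow, hK, one_pow, mul_one, show (24 : AlgebraicClosure ℚ) = 8 * 3 by norm_num,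
          map_mul, h8v, one_mul]; exact ht1.le
    calc t ^ 3 * (v (24 * ε - 64 * K - 24 * K ^ 2) * s ^ 2) ≤ t ^ 3 * (1 * s ^ 2) :=
          mul_le_mul' le_rfl (mul_le_mul' hc le_rfl)
      _ = t ^ 3 * (s * s) := by rw [one_mul, pow_two]
      _ < t ^ 3 * (1 * s) :=
          mul_lt_mul_of_pos_left (mul_lt_mul_of_pos_right hs1 hs0') (pow_pos ht0' 3)
      _ = t ^ 3 * s := by rw [one_mul]
  have hr3 : v (27 * (512 * ε + 64 * K - 24 * K ^ 2)) < t ^ 3 * s := by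
    rw [map_mul, h27]
    have hc0 : v (512 * ε + 64 * K - 24 * K ^ 2) ≤ t ^ 2 := by
      have e : 512 * ε + 64 * K - 24 * K ^ 2 =
          3 ^ 2 * (80 * ε - 48) + D * (208 - 24 * D - 48 * ε) := by
        rw [hD]; linear_combination (-24) * hsq
      rw [e]
      refine (Valuation.map_add _ _ _).trans (max_le ?_ ?_)
      · rw [map_mul, map_pow]
        calc t ^ 2 * v (80 * ε - 48) ≤ t ^ 2 * 1 :=
              mul_le_mul' le_rfl ((Valuation.map_sub _ _ _).trans (max_le
                (by rw [map_mul, hvε, mul_one, show (80 : AlgebraicClosure ℚ) = ((80 : ℤ) : AlgebraicClosure ℚ)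
                  by norm_num, hunit 80 (by decide)])
                (by rw [show (48 : AlgebraicClosure ℚ) = 16 * 3 by norm_num, map_mul,
                  show (16 : AlgebraicClosure ℚ) = ((16 : ℤ) : AlgebraicClosure ℚ) by norm_num,
                  hunit 16 (by decide), one_mul]; exact ht1.le)))
          _ = t ^ 2 := mul_one _
      · rw [map_mul]
        calc v D * v (208 - 24 * D - 48 * ε) ≤ t ^ 2 * 1 := by
              refine mul_le_mul' hKε ((Valuation.map_sub _ _ _).trans (max_le
                ((Valuation.map_sub _ _ _).trans (max_le ?_ ?_)) ?_))
              · rw [show (208 : AlgebraicClosure ℚ) = ((208 : ℤ) : AlgebraicClosure ℚ) by norm_num,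
                  hunit 208 (by decide)]
              · rw [map_mul, show (24 : AlgebraicClosure ℚ) = 8 * 3 by norm_num, map_mul, h8v, one_mul]
                calc t * v D ≤ 1 * 1 := mul_le_mul' ht1.le (hKε.trans (pow_le_one₀ zero_le ht1.le))
                  _ = 1 := mul_one _
              · rw [map_mul, hvε, mul_one, show (48 : AlgebraicClosure ℚ) = 16 * 3 by norm_num, map_mul,
                  show (16 : AlgebraicClosure ℚ) = ((16 : ℤ) : AlgebraicClosure ℚ) by norm_num,
                  hunit 16 (by decide), one_mul]; exact ht1.le
          _ = t ^ 2 := mul_one _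
    calc t ^ 3 * v (512 * ε + 64 * K - 24 * K ^ 2) ≤ t ^ 3 * t ^ 2 := mul_le_mul' le_rfl hc0
      _ < t ^ 3 * s := mul_lt_mul_of_pos_left ht2s (pow_pos ht0' 3)
  have hr4 : v (72 * K * δ ^ 2 * (δ - 1) * (δ + 8)) < t ^ 3 * s := by
    rw [map_mul, map_mul, map_mul, map_mul, h1, h8, mul_one, mul_one, hK, mul_one, map_pow,
      show (72 : AlgebraicClosure ℚ) = 8 * 3 ^ 2 by norm_num, map_mul, map_pow, h8v, one_mul]
    calc t ^ 2 * s ^ 2 = t ^ 2 * s * s := by rw [pow_two s, mul_assoc]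
      _ < t ^ 2 * t * s := mul_lt_mul_of_pos_right (mul_lt_mul_of_pos_left hst (pow_pos ht0' 2)) hs0'
      _ = t ^ 3 * s := by rw [← pow_succ]
  have hrest : v (27 * ((ε - 8 * K) * δ ^ 3) + 27 * ((24 * ε - 64 * K - 24 * K ^ 2) * δ ^ 2) +
      27 * (512 * ε + 64 * K - 24 * K ^ 2) - 72 * K * δ ^ 2 * (δ - 1) * (δ + 8)) < t ^ 3 * s := by
    refine lt_of_le_of_lt (Valuation.map_sub _ _ _) (max_lt ?_ hr4)
    refine lt_of_le_of_lt (Valuation.map_add _ _ _) (max_lt ?_ hr3)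
    exact lt_of_le_of_lt (Valuation.map_add _ _ _) (max_lt hr1 hr2)
  have hsum := congrArg v hid
  rw [map_mul, h8, mul_one, Valuation.map_add_eq_of_lt_left _ (by rw [hmain]; exact hrest), hmain]
    at hsum
  exact hsum

/-- **The level-`9` Hauptmodul at `v₃(j) = 7`, `j/3⁷ ≡ 5, 7 (mod 9)` is valuation-forced after the
unit normalisation.**  Let `ε = ±1`, `j ∈ ℚ` with `9 ∣ num(j/3⁷ − (ε − 3))` (`j/3⁷ ≡ 7` for
`ε = 1`, `≡ 5` for `ε = −1`), and `S, θ ∈ ℚ̄` with `j(S − 27) = S(S − 24)³`, `v(S) = v(3)`,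
`θ³ = S`.  Then **`v((81θ/(2(θ³ − 24)(θ³ − 15)))² − 1)⁹ = v(3)⁴`** — valuation exactly `4/9`.
[cite: Maier2006, Table 4 (N = 3, 9) and §5] -/
theorem valuation_hauptmodul_nine_invariant_seven_e1_pow_nine {j : ℚ} {ε : ℤ}
    (hε : ε = 1 ∨ ε = -1) (hj0 : (9 : ℤ) ∣ (j / 3 ^ 7 - ((ε - 3 : ℤ) : ℚ)).num)
    {S θ : AlgebraicClosure ℚ}
    (hS : algebraMap ℚ (AlgebraicClosure ℚ) j * (S - 27) = S * (S - 24) ^ 3)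
    (hvS : (placeOver 3).valuation S = (placeOver 3).valuation (3 : AlgebraicClosure ℚ))
    (hθ : θ ^ 3 = S) :
    (placeOver 3).valuation ((81 * θ / (2 * (θ ^ 3 - 24) * (θ ^ 3 - 15))) ^ 2 - 1) ^ 9 =
      (placeOver 3).valuation (3 : AlgebraicClosure ℚ) ^ 4 := by
  set v := (placeOver 3).valuation with hv
  set t := v (3 : AlgebraicClosure ℚ) with ht
  have ht0 : t ≠ 0 := valuation_three_ne_zero
  have h3 : (3 : AlgebraicClosure ℚ) ≠ 0 := by norm_num
  have hc3 : ¬ (3 : ℤ) ∣ (ε - 3) := by rcases hε with h | h <;> rw [h] <;> decide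
  have hε' : (ε : AlgebraicClosure ℚ) = 1 ∨ (ε : AlgebraicClosure ℚ) = -1 := by
    rcases hε with h | h
    · left; rw [h]; norm_num
    · right; rw [h]; norm_num
  have hε3' : (ε : AlgebraicClosure ℚ) ^ 3 = ε := by rcases hε' with h | h <;> rw [h] <;> norm_num
  -- `K = j/3⁷ ≡ ε − 3 (mod 9)`
  obtain ⟨hKε, hK, hjK⟩ := valuation_facts_of_nine_dvd_num_sub (V := 7) hc3 hj0
  set K := algebraMap ℚ (AlgebraicClosure ℚ) (j / 3 ^ 7) with hKdef
  simp only [Int.cast_sub, Int.cast_ofNat] at hKε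
  -- `S = 3(δ + 8)`
  obtain ⟨δ, hSδ⟩ : ∃ δ : AlgebraicClosure ℚ, S = 3 * (δ + 8) := ⟨S / 3 - 8, by field_simp; ring⟩
  subst hSδ
  have hR := delta_quartic_of_hauptmodul_three (n := 4) hjK hS rfl
  have h81 : ((3 : AlgebraicClosure ℚ) ^ 4) = 81 := by norm_num
  rw [h81] at hR
  have h8 : v (δ + 8) = 1 := by
    have e : t * v (δ + 8) = t * 1 := by rw [mul_one, ← map_mul]; exact hvS
    exact mul_left_cancel₀ ht0 e
  obtain ⟨h1, hδ3⟩ := valuation_delta_of_quartic (n := 4) hK h8 (by rw [h81]; exact hR)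
  set s := v δ with hs
  obtain ⟨hst, -, hs0⟩ := valuation_delta_facts_seven hδ3
  have hδ0 : δ ≠ 0 := (Valuation.ne_zero_iff _).mp hs0
  have h1' : δ - 1 ≠ 0 := (Valuation.ne_zero_iff _).mp (by rw [h1]; exact one_ne_zero)
  have hK0 : K ≠ 0 := (Valuation.ne_zero_iff _).mp (by rw [hK]; exact one_ne_zero)
  have hδ3v : v (δ + 3) = t := Valuation.map_add_eq_of_lt_right _ hst
  have hδ30 : δ + 3 ≠ 0 := (Valuation.ne_zero_iff _).mp (by rw [hδ3v]; exact ht0)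
  -- `Y = 81θ/(2(θ³ − 24)(θ³ − 15)) = 9θ/(2δ(δ + 3))`
  have hθδ : θ ^ 3 - 24 = 3 * δ := by rw [hθ]; ring
  have hθδ' : θ ^ 3 - 15 = 3 * (δ + 3) := by rw [hθ]; ring
  set Y := 81 * θ / (2 * (θ ^ 3 - 24) * (θ ^ 3 - 15)) with hYdef
  have hY : Y * (2 * δ * (δ + 3)) = 9 * θ := by
    have hne : 2 * (θ ^ 3 - 24) * (θ ^ 3 - 15) ≠ 0 := by
      rw [hθδ, hθδ']
      exact mul_ne_zero (mul_ne_zero two_ne_zero (mul_ne_zero h3 hδ0)) (mul_ne_zero h3 hδ30)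
    have e : Y * (2 * (θ ^ 3 - 24) * (θ ^ 3 - 15)) = 81 * θ := div_mul_cancel₀ _ hne
    rw [hθδ, hθδ'] at e
    have e' : (9 : AlgebraicClosure ℚ) * (Y * (2 * δ * (δ + 3)) - 9 * θ) = 0 := by linear_combination e
    exact sub_eq_zero.mp ((mul_eq_zero.mp e').resolve_left (by norm_num))
  -- `(X³ − 1)·8δ³(δ + 3)³(δ + 8) = 81·N`
  have hX3 : (((ε : AlgebraicClosure ℚ) * Y) ^ 3 - 1) * (8 * δ ^ 3 * (δ + 3) ^ 3 * (δ + 8)) =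
      81 * (27 * ε * (δ + 8) ^ 2 - 8 * K * (δ - 1) * (δ + 3) ^ 3) := by
    linear_combination ((ε : AlgebraicClosure ℚ) ^ 3 * (δ + 8) *
        ((Y * (2 * δ * (δ + 3))) ^ 2 + Y * (2 * δ * (δ + 3)) * (9 * θ) + 81 * θ ^ 2)) * hY +
      (729 * (ε : AlgebraicClosure ℚ) ^ 3 * (δ + 8)) * hθ + (2187 * (δ + 8) ^ 2) * hε3' +
      (-8 * (δ + 3) ^ 3) * hR
  have hN := valuation_numerator_seven_e1 hε' hKε hK h8 hR hδ3
  have h8v : v (8 : AlgebraicClosure ℚ) = 1 := by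
    simpa using valuation_intCast_eq_one_of_not_dvd (n := 8) (by decide)
  have h81v : v (81 : AlgebraicClosure ℚ) = t ^ 4 := by rw [← h81, map_pow]
  have hval := congrArg v hX3
  rw [map_mul, map_mul, map_mul, map_mul, map_pow, h8v, one_mul, h8, mul_one, map_pow, hδ3v, hδ3,
    map_mul, h81v, hN] at hval
  change v (((ε : AlgebraicClosure ℚ) * Y) ^ 3 - 1) * (t ^ 4 * t ^ 3) = t ^ 4 * (t ^ 3 * s) at hval
  have hA : v (((ε : AlgebraicClosure ℚ) * Y) ^ 3 - 1) = s := by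
    have e : v (((ε : AlgebraicClosure ℚ) * Y) ^ 3 - 1) * (t ^ 4 * t ^ 3) = s * (t ^ 4 * t ^ 3) := by
      rw [hval, mul_comm s (t ^ 4 * t ^ 3), mul_assoc]
    exact mul_right_cancel₀ (mul_ne_zero (pow_ne_zero 4 ht0) (pow_ne_zero 3 ht0)) e
  have hcube : v (((ε : AlgebraicClosure ℚ) * Y) ^ 3 - 1) ^ 3 = t ^ 4 := by rw [hA, hs, hδ3]
  exact valuation_sq_sub_one_pow_nine_of_cube_pow_four hε' hcube

end Summit.BirchSwinnertonDyer.Rank1Residual.GaloisImage
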